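/-
Copyright (c) 2026 the pub-hodgecm-mathlib formalisation cell (harness21).  Prover seat hodgecm-mathlib-K2E5-p10 (g5), Track B «K2-LIT» ∕ h413
(`stmt-HodgeConjecture-24833`), line `K2_E3_EllipticInputs`, unit U12, §L road «U-iso-T» brick (G⁺-b)/(K4-b⁺): THE TWISTED `K`-AVERAGES OF THE TRUNCATED
QUADRATIC-CHARACTER WEIGHT — BRIDGE TO THE CELL INTEGRALS AND THE UNIFORM DOMINATION `|A_n X| ≤ C·|disc χ_X|^{-1∕2}`.  2026-09-04.
-/
import Summits.HodgeConjecture.HodgeConjecture.Theorems.K2E3GL2TwistedWeightCellsSigned        -- ★ p857447 (K2E5-p10 g4): (K3±) `integral_glInt_detEntryWeight_eq_cells`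
import Summits.HodgeConjecture.HodgeConjecture.Theorems.K2E3LocalFieldQuadraticWeightBoundSplit  -- ★ p857576 (K2E5-p10 g4): (K4-b2) split bound; brings (K4-b1) p857536, (K4-a) p857503, (K4-S), (K4-E)
import HarnessLib

/-!
# K2_E3 road (h413), §L brick (G⁺-b)/(K4-b⁺) — the twisted `K`-averages: bridge to the cell integrals and uniform domination

Cell `pub/hodgecm-mathlib` (D-0151), Track B, seat K2E5-p10 (g5) (E3 §L line, lead K2E3-p12 (g5); dealer K2E3-plan (g3); the `K`-side of (G⁺-b) built by
this base's g4).  `--supports stmt-HodgeConjecture-24833 --as helper`; THEOREMS ONLY (no definition ∕ instance ∕ notation ∕ named fact ∕ `sorry`); never imports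
`Cruxes/…/Lines`.  COUNT-NEUTRAL.

Frozen currency (§L bus 2026-09-04 05:25Z): `χ` a quadratic quasi-character of the non-archimedean local field `F` (`χ² = 1`, `χ ≠ 1`),
`χ̃ = Function.extend Units.val χ 0`, the truncated line weight `ω_n(y) = 1[y ∉ 𝔭^{2n}] χ̃(y)‖y‖⁻¹`, the cell integrals
`B_n(β; r₀,r₁,r₂) = ∫_{𝔭^β} ω_n(r₀ + r₁σ + r₂σ²) dσ` and the TWISTED `K`-AVERAGE `A_n(X) = ∫_K χ̃(det k)·ω_n((k⁻¹Xk)₁₀) dκ` (`K = GL₂(𝒪)`, `κ` Haar).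
* §1 the twisted integrand `χ̃(d)·ω_n(s)` is REAL (`χ̃ ∈ {0, ±1}`), bounded by `q^{2n}`, measurable, and invariant under `(d, s) ↦ (du, vs)` for `u, v ∈ 𝒪ˣ`
  with `uv ∈ (Fˣ)²` (`χ(u)χ(v) = χ(r²) = 1`);
* §2 **`exists_twistedKAverage_eq_cells`** (BRIDGE): `A_n(X) = c·(B_n(0; P_X) + χ̃(−1)·B_n(1; Q_X))`, `P_X = (X₁₀, X₁₁−X₀₀, −X₀₁)`, `Q_X = (X₀₁, X₀₀−X₁₁, −X₁₀)`,
  ONE `c > 0` for all `n, X` — the signed cell formula ★ (K3±) applied to the real weight `Re(χ̃(d)ω_n(s))`;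
* §3 **`exists_forall_norm_setIntegral_trunc_quadratic_le`** (1-D MASTER BOUND): `|∫_{𝔭^β} 1[R ∉ 𝔭^b] χ̃(R)‖R‖⁻¹| ≤ C₀·|r₁² − 4r₀r₂|^{-1∕2}` for every `b, β` and every
  `R = r₀ + r₁σ + r₂σ²` of non-zero discriminant (`char F ≠ 2`) — LINEAR ★ `norm_setIntegral_trunc_linear_le`, ELLIPTIC ★ `norm_setIntegral_trunc_elliptic_le`,
  SPLIT ★ `norm_setIntegral_trunc_split_le` (conductor ball ★ `exists_conductorBall`), with `√|disc|` identified in each case;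
* §4 **`exists_twistedKAverage_bound`** (DOMINATION): `|A_n(X)| ≤ C·|disc χ_X|^{-1∕2}` for all `n` and all `X` with `disc χ_X ≠ 0`
  (`disc P_X = disc Q_X = disc χ_X`, Mathlib `Matrix.discr_fin_two`).
[HarishChandra1999AdmissibleDistributions, §7] [LabesseLanglands1979, §2]
HONEST LABEL: HC_CM is proved only modulo the 7 printed citations (2 remaining named inputs: hLiu418 = stmt-HodgeConjecture-24832, h413 =
stmt-HodgeConjecture-24833) until rung 0 closes; count-neutral helper toward (LBU-2⁺)∕(G⁺-b), NOT ★.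

## References
* [HarishChandra1999AdmissibleDistributions] Harish-Chandra (DeBacker–Sally), *Admissible Invariant Distributions on Reductive p-adic Groups* (1999), §7.
* [LabesseLanglands1979] J.-P. Labesse, R. P. Langlands, *L-indistinguishability for SL(2)*, Canad. J. Math. 31 (1979), §2.
-/

set_option autoImplicit false
set_option linter.dupNamespace false   -- `Summit.HodgeConjecture.HodgeConjecture.…` (D-0017 nested layout; lakefile exemption for Summits)

noncomputable section

open MeasureTheory Measure Filter Topology Set
open scoped MatrixGroups NNReal ENNReal Pointwise
open ValuativeRel
open Literature.NumberTheory.Rogawski1990 Literature.NumberTheory.Automorphic Literature.NumberTheory.Automorphic.LocalFieldHaar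
open Literature.NumberTheory.Automorphic.TateDirect
open Literature.NumberTheory.GaloisRepresentations Literature.NumberTheory.GaloisRepresentations.IsNonarchimedeanLocalField
open Summit.HodgeConjecture.HodgeConjecture.Cruxes.H413.K2E3GL2TwistedWeightCellsSigned
open Summit.HodgeConjecture.HodgeConjecture.Cruxes.H413.K2E3LocalFieldSignCharZetaBalls
open Summit.HodgeConjecture.HodgeConjecture.Cruxes.H413.K2E3LocalFieldQuadraticCharSignWeight
open Summit.HodgeConjecture.HodgeConjecture.Cruxes.H413.K2E3LocalFieldQuadraticCharLocalisation
open Summit.HodgeConjecture.HodgeConjecture.Cruxes.H413.K2E3LocalFieldQuadraticWeightEventuallyConst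
open Summit.HodgeConjecture.HodgeConjecture.Cruxes.H413.K2E3LocalFieldQuadraticWeightBoundLemmas
open Summit.HodgeConjecture.HodgeConjecture.Cruxes.H413.K2E3LocalFieldQuadraticWeightBoundSplit

namespace Summit.HodgeConjecture.HodgeConjecture.Cruxes.H413.K2E3GL2TwistedKAverageCells

variable {F : Type*} [Field F] [ValuativeRel F] [TopologicalSpace F] [IsNonarchimedeanLocalField F]

/-! ## §1  The twisted truncated weight is real, bounded, measurable and `(𝒪ˣ)²`-invariant -/

omit [ValuativeRel F] [IsNonarchimedeanLocalField F] in
/-- A quadratic `χ̃` is real-valued: `Im χ̃(y) = 0` (`χ̃(y) ∈ {0, ±1}`). [folklore] -/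
theorem extend_im_eq_zero (χ : QuasiChar F) (hχ2 : ∀ u, χ u * χ u = 1) (y : F) :
    (Function.extend ((↑) : Fˣ → F) (fun u => ((χ u : ℂˣ) : ℂ)) 0 y).im = 0 := by
  by_cases hy : y = 0
  · rw [hy, extend_apply_zero, Complex.zero_im]
  · rw [extend_apply_of_ne_zero χ hy]
    have h : ((χ (Units.mk0 y hy) : ℂˣ) : ℂ) * ((χ (Units.mk0 y hy) : ℂˣ) : ℂ) = 1 := by
      rw [← Units.val_mul, hχ2, Units.val_one]
    rcases mul_self_eq_one_iff.1 h with h1 | h1 <;> rw [h1]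
    · exact Complex.one_im
    · rw [Complex.neg_im, Complex.one_im, neg_zero]

/-- The truncated weight `ω_b(y) = 1[y ∉ 𝔭^b] χ̃(y)‖y‖⁻¹` of a quadratic `χ` is real-valued. [folklore] -/
theorem truncWeight_im_eq_zero (χ : QuasiChar F) (hχ2 : ∀ u, χ u * χ u = 1) (b : ℤ) (y : F) :
    ((primePowBall F b)ᶜ.indicator
        (fun y => Function.extend ((↑) : Fˣ → F) (fun u => ((χ u : ℂˣ) : ℂ)) 0 y * ((((normAbs F y)⁻¹ : ℝ≥0) : ℝ) : ℂ)) y).im = 0 := by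
  by_cases hy : y ∈ (primePowBall F b)ᶜ
  · rw [indicator_of_mem hy, Complex.mul_im, Complex.ofReal_im, Complex.ofReal_re, extend_im_eq_zero χ hχ2, mul_zero, zero_mul, add_zero]
  · rw [indicator_of_notMem hy, Complex.zero_im]

/-- The twisted truncated integrand `χ̃(d)·ω_b(s)` of a quadratic `χ` is real-valued. [folklore] -/
theorem twistedTruncWeight_im_eq_zero (χ : QuasiChar F) (hχ2 : ∀ u, χ u * χ u = 1) (b : ℤ) (d s : F) :
    (Function.extend ((↑) : Fˣ → F) (fun u => ((χ u : ℂˣ) : ℂ)) 0 d *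
      (primePowBall F b)ᶜ.indicator
        (fun y => Function.extend ((↑) : Fˣ → F) (fun u => ((χ u : ℂˣ) : ℂ)) 0 y * ((((normAbs F y)⁻¹ : ℝ≥0) : ℝ) : ℂ)) s).im = 0 := by
  rw [Complex.mul_im, extend_im_eq_zero χ hχ2, truncWeight_im_eq_zero χ hχ2, mul_zero, zero_mul, add_zero]

/-- `χ̃(d)·ω_b(s)` equals the real number `Re(χ̃(d)·ω_b(s))` (cast back to `ℂ`). [folklore] -/
theorem ofReal_re_twistedTruncWeight (χ : QuasiChar F) (hχ2 : ∀ u, χ u * χ u = 1) (b : ℤ) (d s : F) :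
    (((Function.extend ((↑) : Fˣ → F) (fun u => ((χ u : ℂˣ) : ℂ)) 0 d *
      (primePowBall F b)ᶜ.indicator
        (fun y => Function.extend ((↑) : Fˣ → F) (fun u => ((χ u : ℂˣ) : ℂ)) 0 y * ((((normAbs F y)⁻¹ : ℝ≥0) : ℝ) : ℂ)) s).re : ℝ) : ℂ) =
    Function.extend ((↑) : Fˣ → F) (fun u => ((χ u : ℂˣ) : ℂ)) 0 d *
      (primePowBall F b)ᶜ.indicator
        (fun y => Function.extend ((↑) : Fˣ → F) (fun u => ((χ u : ℂˣ) : ℂ)) 0 y * ((((normAbs F y)⁻¹ : ℝ≥0) : ℝ) : ℂ)) s :=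
  Complex.ext (Complex.ofReal_re _) (by rw [Complex.ofReal_im, twistedTruncWeight_im_eq_zero χ hχ2])

/-- **Bound**: `‖χ̃(d)·ω_b(s)‖ ≤ q^b` (`‖χ̃‖ ≤ 1`, ★ `norm_truncWeight_le`). [folklore] -/
theorem norm_twistedTruncWeight_le (χ : QuasiChar F) (hχ2 : ∀ u, χ u * χ u = 1) (b : ℤ) (d s : F) :
    ‖Function.extend ((↑) : Fˣ → F) (fun u => ((χ u : ℂˣ) : ℂ)) 0 d *
      (primePowBall F b)ᶜ.indicator
        (fun y => Function.extend ((↑) : Fˣ → F) (fun u => ((χ u : ℂˣ) : ℂ)) 0 y * ((((normAbs F y)⁻¹ : ℝ≥0) : ℝ) : ℂ)) s‖ ≤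
      (residueFieldCard F : ℝ) ^ b := by
  rw [norm_mul]
  calc _ ≤ 1 * (residueFieldCard F : ℝ) ^ b :=
        mul_le_mul (norm_extend_le_one χ hχ2 d) (norm_truncWeight_le χ hχ2 b s) (norm_nonneg _) zero_le_one
    _ = _ := one_mul _

/-- **Invariance**: `χ̃(d·u)·ω_b(v·s) = χ̃(d)·ω_b(s)` for `u, v ∈ 𝒪ˣ` with `u·v` a square (`χ(u)χ(v) = χ(r)² = 1`, `‖vs‖ = ‖s‖`).
[cite: LabesseLanglands1979, §2] -/
theorem twistedTruncWeight_invariant (χ : QuasiChar F) (hχ2 : ∀ u, χ u * χ u = 1) (b : ℤ) (d s : F) (u v : Fˣ)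
    (hv : normAbs F (v : F) = 1) (huv : IsSquare (u * v)) :
    Function.extend ((↑) : Fˣ → F) (fun u => ((χ u : ℂˣ) : ℂ)) 0 (d * u) *
      (primePowBall F b)ᶜ.indicator
        (fun y => Function.extend ((↑) : Fˣ → F) (fun u => ((χ u : ℂˣ) : ℂ)) 0 y * ((((normAbs F y)⁻¹ : ℝ≥0) : ℝ) : ℂ)) (v * s) =
    Function.extend ((↑) : Fˣ → F) (fun u => ((χ u : ℂˣ) : ℂ)) 0 d *
      (primePowBall F b)ᶜ.indicator
        (fun y => Function.extend ((↑) : Fˣ → F) (fun u => ((χ u : ℂˣ) : ℂ)) 0 y * ((((normAbs F y)⁻¹ : ℝ≥0) : ℝ) : ℂ)) s := by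
  obtain ⟨r, hr⟩ := huv
  have hχuv : ((χ u : ℂˣ) : ℂ) * ((χ v : ℂˣ) : ℂ) = 1 := by
    rw [← Units.val_mul, ← map_mul, hr, map_mul, hχ2, Units.val_one]
  have hdu : Function.extend ((↑) : Fˣ → F) (fun u => ((χ u : ℂˣ) : ℂ)) 0 (d * u) =
      ((χ u : ℂˣ) : ℂ) * Function.extend ((↑) : Fˣ → F) (fun u => ((χ u : ℂˣ) : ℂ)) 0 d := by
    rw [mul_comm d, extend_coe_mul]
  have hmem : (v : F) * s ∈ (primePowBall F b)ᶜ ↔ s ∈ (primePowBall F b)ᶜ := by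
    rw [mem_compl_iff, mem_compl_iff, mem_primePowBall_iff, mem_primePowBall_iff, map_mul, hv, one_mul]
  by_cases hs : s ∈ (primePowBall F b)ᶜ
  · rw [indicator_of_mem (hmem.2 hs), indicator_of_mem hs, hdu, extend_coe_mul, map_mul, hv, one_mul]
    calc _ = (((χ u : ℂˣ) : ℂ) * ((χ v : ℂˣ) : ℂ)) * (Function.extend ((↑) : Fˣ → F) (fun u => ((χ u : ℂˣ) : ℂ)) 0 d *
          (Function.extend ((↑) : Fˣ → F) (fun u => ((χ u : ℂˣ) : ℂ)) 0 s * ((((normAbs F s)⁻¹ : ℝ≥0) : ℝ) : ℂ))) := by ring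
      _ = _ := by rw [hχuv, one_mul]
  · rw [indicator_of_notMem (fun h => hs (hmem.1 h)), indicator_of_notMem hs, mul_zero, mul_zero]

/-- **Measurability** of the real weight `(d, s) ↦ Re(χ̃(d)·ω_b(s))`. [folklore] -/
theorem measurable_re_twistedTruncWeight [MeasurableSpace F] [BorelSpace F] (χ : QuasiChar F) (b : ℤ) :
    Measurable (Function.uncurry fun d s : F => (Function.extend ((↑) : Fˣ → F) (fun u => ((χ u : ℂˣ) : ℂ)) 0 d *
      (primePowBall F b)ᶜ.indicator
        (fun y => Function.extend ((↑) : Fˣ → F) (fun u => ((χ u : ℂˣ) : ℂ)) 0 y * ((((normAbs F y)⁻¹ : ℝ≥0) : ℝ) : ℂ)) s).re) := by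
  have hω : Measurable fun y : F => (primePowBall F b)ᶜ.indicator
      (fun y => Function.extend ((↑) : Fˣ → F) (fun u => ((χ u : ℂˣ) : ℂ)) 0 y * ((((normAbs F y)⁻¹ : ℝ≥0) : ℝ) : ℂ)) y :=
    ((measurable_extend χ).mul measurable_normInv).indicator (measurableSet_primePowBall b).compl
  exact Complex.measurable_re.comp (((measurable_extend χ).comp measurable_fst).mul (hω.comp measurable_snd))

/-! ## §2  The bridge: `A_n = c·(B_n(0; P_X) + χ̃(−1)·B_n(1; Q_X))` -/

section Main
variable [MeasurableSpace F] [BorelSpace F] (dx : Measure F) [dx.IsAddHaarMeasure]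

section Bridge
variable [MeasurableSpace (GL (Fin 2) F)] [BorelSpace (GL (Fin 2) F)]

/-- **THE BRIDGE TO THE CELL INTEGRALS.**  For `κ` Haar on `K = GL₂(𝒪)` and `dx` additive Haar on `F` there is ONE `c > 0` such that for every `n : ℕ` and every
`X ∈ 𝔤𝔩₂(F)` the twisted `K`-average of the truncated weight `ω_n = 1[· ∉ 𝔭^{2n}] χ̃ ‖·‖⁻¹` is
`A_n(X) = ∫_K χ̃(det k)·ω_n((k⁻¹Xk)₁₀) dκ = c·(∫_{σ ∈ 𝒪} ω_n(X₁₀ + (X₁₁−X₀₀)σ − X₀₁σ²) dσ + χ̃(−1)·∫_{σ ∈ 𝔭} ω_n(X₀₁ + (X₀₀−X₁₁)σ − X₁₀σ²) dσ)`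
(the signed cell formula ★ (K3±) for the REAL invariant weight `Re(χ̃(d)·ω_n(s))`, `χ² = 1`).
[cite: HarishChandra1999AdmissibleDistributions, §7] [cite: LabesseLanglands1979, §2] -/
theorem exists_twistedKAverage_eq_cells (χ : QuasiChar F) (hχ2 : ∀ u, χ u * χ u = 1) (κ : Measure ↥(glInt 2 F)) [κ.IsHaarMeasure] :
    ∃ c : ℝ, 0 < c ∧ ∀ (n : ℕ) (X : Matrix (Fin 2) (Fin 2) F),
      ∫ k : ↥(glInt 2 F), Function.extend ((↑) : Fˣ → F) (fun u => ((χ u : ℂˣ) : ℂ)) 0 (((k : GL (Fin 2) F) : Matrix (Fin 2) (Fin 2) F)).det *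
          (primePowBall F (2 * (n : ℤ)))ᶜ.indicator
            (fun y => Function.extend ((↑) : Fˣ → F) (fun u => ((χ u : ℂˣ) : ℂ)) 0 y * ((((normAbs F y)⁻¹ : ℝ≥0) : ℝ) : ℂ))
            ((((((k : GL (Fin 2) F))⁻¹ : GL (Fin 2) F) : Matrix (Fin 2) (Fin 2) F) * X * ((k : GL (Fin 2) F) : Matrix (Fin 2) (Fin 2) F)) 1 0) ∂κ =
        (c : ℂ) * ((∫ σ in primePowBall F 0, (primePowBall F (2 * (n : ℤ)))ᶜ.indicator
            (fun y => Function.extend ((↑) : Fˣ → F) (fun u => ((χ u : ℂˣ) : ℂ)) 0 y * ((((normAbs F y)⁻¹ : ℝ≥0) : ℝ) : ℂ))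
            (X 1 0 + (X 1 1 - X 0 0) * σ + -X 0 1 * σ ^ 2) ∂dx) +
          Function.extend ((↑) : Fˣ → F) (fun u => ((χ u : ℂˣ) : ℂ)) 0 (-1) *
            ∫ σ in primePowBall F 1, (primePowBall F (2 * (n : ℤ)))ᶜ.indicator
              (fun y => Function.extend ((↑) : Fˣ → F) (fun u => ((χ u : ℂˣ) : ℂ)) 0 y * ((((normAbs F y)⁻¹ : ℝ≥0) : ℝ) : ℂ))
              (X 0 1 + (X 0 0 - X 1 1) * σ + -X 1 0 * σ ^ 2) ∂dx) := by
  obtain ⟨c, hc, hcells⟩ := integral_glInt_detEntryWeight_eq_cells dx κ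
  refine ⟨c, hc, fun n X => ?_⟩
  -- the real weight `Ω(d, s) = Re(χ̃(d)·ω_n(s))`
  set Ω : F → F → ℝ := fun d s => (Function.extend ((↑) : Fˣ → F) (fun u => ((χ u : ℂˣ) : ℂ)) 0 d *
      (primePowBall F (2 * (n : ℤ)))ᶜ.indicator
        (fun y => Function.extend ((↑) : Fˣ → F) (fun u => ((χ u : ℂˣ) : ℂ)) 0 y * ((((normAbs F y)⁻¹ : ℝ≥0) : ℝ) : ℂ)) s).re with hΩ
  have hΩC : ∀ d s : F, ((Ω d s : ℝ) : ℂ) = Function.extend ((↑) : Fˣ → F) (fun u => ((χ u : ℂˣ) : ℂ)) 0 d *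
      (primePowBall F (2 * (n : ℤ)))ᶜ.indicator
        (fun y => Function.extend ((↑) : Fˣ → F) (fun u => ((χ u : ℂˣ) : ℂ)) 0 y * ((((normAbs F y)⁻¹ : ℝ≥0) : ℝ) : ℂ)) s :=
    fun d s => ofReal_re_twistedTruncWeight χ hχ2 _ d s
  have h := hcells Ω (measurable_re_twistedTruncWeight χ _) ((residueFieldCard F : ℝ) ^ (2 * (n : ℤ)))
    (fun d s => (Complex.abs_re_le_norm _).trans (norm_twistedTruncWeight_le χ hχ2 _ d s))
    (fun d s u v _ hv huv => by simp only [hΩ, twistedTruncWeight_invariant χ hχ2 _ d s u v hv huv]) X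
  -- `χ̃(1) = 1`
  have h1 : Function.extend ((↑) : Fˣ → F) (fun u => ((χ u : ℂˣ) : ℂ)) 0 1 = 1 := by
    rw [show (1 : F) = ((1 : Fˣ) : F) from Units.val_one.symm, extend_apply_coe, map_one, Units.val_one]
  -- the three conversions real ↔ complex
  have hK : ∀ k : ↥(glInt 2 F), Function.extend ((↑) : Fˣ → F) (fun u => ((χ u : ℂˣ) : ℂ)) 0 (((k : GL (Fin 2) F) : Matrix (Fin 2) (Fin 2) F)).det *
      (primePowBall F (2 * (n : ℤ)))ᶜ.indicator
        (fun y => Function.extend ((↑) : Fˣ → F) (fun u => ((χ u : ℂˣ) : ℂ)) 0 y * ((((normAbs F y)⁻¹ : ℝ≥0) : ℝ) : ℂ))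
        ((((((k : GL (Fin 2) F))⁻¹ : GL (Fin 2) F) : Matrix (Fin 2) (Fin 2) F) * X * ((k : GL (Fin 2) F) : Matrix (Fin 2) (Fin 2) F)) 1 0) =
      ((Ω (((k : GL (Fin 2) F) : Matrix (Fin 2) (Fin 2) F)).det
        ((((((k : GL (Fin 2) F))⁻¹ : GL (Fin 2) F) : Matrix (Fin 2) (Fin 2) F) * X * ((k : GL (Fin 2) F) : Matrix (Fin 2) (Fin 2) F)) 1 0) : ℝ) : ℂ) :=
    fun k => (hΩC _ _).symm
  have hP : ∀ σ : F, ((Ω 1 (X 1 0 + σ * (X 1 1 - X 0 0) - σ ^ 2 * X 0 1) : ℝ) : ℂ) =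
      (primePowBall F (2 * (n : ℤ)))ᶜ.indicator
        (fun y => Function.extend ((↑) : Fˣ → F) (fun u => ((χ u : ℂˣ) : ℂ)) 0 y * ((((normAbs F y)⁻¹ : ℝ≥0) : ℝ) : ℂ))
        (X 1 0 + (X 1 1 - X 0 0) * σ + -X 0 1 * σ ^ 2) := by
    intro σ
    rw [hΩC, h1, one_mul, show X 1 0 + σ * (X 1 1 - X 0 0) - σ ^ 2 * X 0 1 = X 1 0 + (X 1 1 - X 0 0) * σ + -X 0 1 * σ ^ 2 by ring]
  have hQ : ∀ σ : F, ((Ω (-1) (X 0 1 + σ * (X 0 0 - X 1 1) - σ ^ 2 * X 1 0) : ℝ) : ℂ) =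
      Function.extend ((↑) : Fˣ → F) (fun u => ((χ u : ℂˣ) : ℂ)) 0 (-1) *
        (primePowBall F (2 * (n : ℤ)))ᶜ.indicator
          (fun y => Function.extend ((↑) : Fˣ → F) (fun u => ((χ u : ℂˣ) : ℂ)) 0 y * ((((normAbs F y)⁻¹ : ℝ≥0) : ℝ) : ℂ))
          (X 0 1 + (X 0 0 - X 1 1) * σ + -X 1 0 * σ ^ 2) := by
    intro σ
    rw [hΩC, show X 0 1 + σ * (X 0 0 - X 1 1) - σ ^ 2 * X 1 0 = X 0 1 + (X 0 0 - X 1 1) * σ + -X 1 0 * σ ^ 2 by ring]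
  simp_rw [hK]
  rw [integral_complex_ofReal, h, Complex.ofReal_mul, Complex.ofReal_add, ← integral_complex_ofReal, ← integral_complex_ofReal]
  simp_rw [hP, hQ]
  rw [integral_const_mul]

end Bridge

/-! ## §3  The one-dimensional master bound -/

/-- **THE 1-D MASTER BOUND, UNIFORM IN THE TRUNCATION AND THE BALL.**  For a quadratic `χ ≠ 1` (`χ² = 1`, `char F ≠ 2`) there is `C₀ ≥ 0` with
`|∫_{𝔭^β} 1[R σ ∉ 𝔭^b] χ̃(R σ)‖R σ‖⁻¹ dσ| ≤ C₀·|r₁² − 4r₀r₂|^{-1∕2}` for all `b, β ∈ ℤ` and all `R = r₀ + r₁σ + r₂σ²` with `r₁² − 4r₀r₂ ≠ 0`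
(LINEAR `r₂ = 0`: ★ `norm_setIntegral_trunc_linear_le`, `√|disc| = ‖r₁‖`; ELLIPTIC: ★ `norm_setIntegral_trunc_elliptic_le`, `√‖Δ‖ = √|disc|·‖2r₂‖⁻¹`;
SPLIT `disc = s²`: ★ `norm_setIntegral_trunc_split_le`, `‖r₂(σ₁−σ₂)‖ = ‖s‖ = √|disc|`; `C₀ = (4 + 2‖2‖⁻¹ + q^e)·μ(𝒪)`, `𝔭^e` a conductor ball of `χ`).
[cite: HarishChandra1999AdmissibleDistributions, §7] [cite: LabesseLanglands1979, §2] -/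
theorem exists_forall_norm_setIntegral_trunc_quadratic_le (h2 : (2 : F) ≠ 0) (χ : QuasiChar F) (hχ2 : ∀ u, χ u * χ u = 1) (hχ1 : ∃ u, χ u ≠ 1) :
    ∃ C₀ : ℝ, 0 ≤ C₀ ∧ ∀ (b β : ℤ) (r₀ r₁ r₂ : F), r₁ ^ 2 - 4 * r₀ * r₂ ≠ 0 →
      ‖∫ σ in primePowBall F β, (primePowBall F b)ᶜ.indicator
          (fun y => Function.extend ((↑) : Fˣ → F) (fun u => ((χ u : ℂˣ) : ℂ)) 0 y * ((((normAbs F y)⁻¹ : ℝ≥0) : ℝ) : ℂ)) (r₀ + r₁ * σ + r₂ * σ ^ 2) ∂dx‖ ≤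
        C₀ * (((NNReal.sqrt (normAbs F (r₁ ^ 2 - 4 * r₀ * r₂)))⁻¹ : ℝ≥0) : ℝ) := by
  obtain ⟨e, he1, hce⟩ := exists_conductorBall χ
  have hμ0 : 0 ≤ dx.real (primePowBall F 0) := measureReal_nonneg
  have h20 : 0 < (normAbs F 2 : ℝ) := by exact_mod_cast pos_iff_ne_zero.2 ((map_ne_zero (normAbs F)).2 h2)
  have hqe : 0 ≤ (residueFieldCard F : ℝ) ^ e := by positivity
  refine ⟨(4 + 2 * ((normAbs F 2 : ℝ))⁻¹ + (residueFieldCard F : ℝ) ^ e) * dx.real (primePowBall F 0), by positivity,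
    fun b β r₀ r₁ r₂ hD => ?_⟩
  -- each case constant is `≤ C₀`
  have hcase : ∀ {a : ℝ}, a ≤ 4 + 2 * ((normAbs F 2 : ℝ))⁻¹ + (residueFieldCard F : ℝ) ^ e →
      ∀ {I : ℝ}, I ≤ a * (((NNReal.sqrt (normAbs F (r₁ ^ 2 - 4 * r₀ * r₂)))⁻¹ : ℝ≥0) : ℝ) * dx.real (primePowBall F 0) →
        I ≤ (4 + 2 * ((normAbs F 2 : ℝ))⁻¹ + (residueFieldCard F : ℝ) ^ e) * dx.real (primePowBall F 0) *
          (((NNReal.sqrt (normAbs F (r₁ ^ 2 - 4 * r₀ * r₂)))⁻¹ : ℝ≥0) : ℝ) := by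
    intro a ha I hI
    calc I ≤ _ := hI
      _ ≤ (4 + 2 * ((normAbs F 2 : ℝ))⁻¹ + (residueFieldCard F : ℝ) ^ e) *
            (((NNReal.sqrt (normAbs F (r₁ ^ 2 - 4 * r₀ * r₂)))⁻¹ : ℝ≥0) : ℝ) * dx.real (primePowBall F 0) :=
          mul_le_mul_of_nonneg_right (mul_le_mul_of_nonneg_right ha (NNReal.coe_nonneg _)) hμ0
      _ = _ := by ring
  have hn2 : normAbs F 2 ≠ 0 := (map_ne_zero (normAbs F)).2 h2
  by_cases hr₂ : r₂ = 0
  · ----------------------------------------------------------------- LINEAR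
    subst hr₂
    have hr₁ : r₁ ≠ 0 := by intro h; apply hD; rw [h]; ring
    set σ₁ : F := -r₀ / r₁ with hσ₁
    have hR : ∀ σ : F, r₀ + r₁ * σ + 0 * σ ^ 2 = r₁ * (σ - σ₁) := fun σ => by rw [hσ₁]; field_simp; ring
    have hsq : NNReal.sqrt (normAbs F (r₁ ^ 2 - 4 * r₀ * 0)) = normAbs F r₁ := by
      rw [mul_zero, sub_zero, map_pow, NNReal.sqrt_sq]
    simp_rw [hR]
    refine hcase (a := 1) (by linarith [inv_pos.2 h20, hqe]) ?_
    rw [one_mul, hsq, NNReal.coe_inv]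
    exact norm_setIntegral_trunc_linear_le dx χ hχ2 hχ1 hr₁ σ₁ b β
  · by_cases hsq : IsSquare (r₁ ^ 2 - 4 * r₀ * r₂)
    · --------------------------------------------------------------- SPLIT
      obtain ⟨s, hs⟩ := hsq
      have hs0 : s ≠ 0 := by rintro rfl; exact hD (by rw [hs, mul_zero])
      set σ₁ : F := (-r₁ + s) / (2 * r₂) with hσ₁
      set σ₂ : F := (-r₁ - s) / (2 * r₂) with hσ₂
      have hd : r₂ * (σ₁ - σ₂) = s := by rw [hσ₁, hσ₂]; field_simp; ring
      have hne : σ₁ ≠ σ₂ := by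
        intro h; apply hs0; rw [← hd, h, sub_self, mul_zero]
      have hR : ∀ σ : F, r₀ + r₁ * σ + r₂ * σ ^ 2 = r₂ * (σ - σ₁) * (σ - σ₂) := by
        intro σ; rw [hσ₁, hσ₂]; field_simp; linear_combination (-1 : F) * hs
      have hsqrt : NNReal.sqrt (normAbs F (r₁ ^ 2 - 4 * r₀ * r₂)) = normAbs F (r₂ * (σ₁ - σ₂)) := by
        rw [hs, hd, map_mul, NNReal.sqrt_mul_self]
      simp_rw [hR]
      refine hcase (a := 3 + (residueFieldCard F : ℝ) ^ e) (by linarith [inv_pos.2 h20, hqe]) ?_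
      rw [hsqrt, NNReal.coe_inv]
      exact norm_setIntegral_trunc_split_le dx χ hχ2 hχ1 he1 hce hr₂ hne b β
    · --------------------------------------------------------------- ELLIPTIC
      set u : F := -r₁ / (2 * r₂) with hu
      set Δ : F := (r₁ ^ 2 - 4 * r₀ * r₂) / (2 * r₂) ^ 2 with hΔ
      have hR : ∀ σ : F, r₀ + r₁ * σ + r₂ * σ ^ 2 = r₂ * ((σ - u) ^ 2 - Δ) := by
        intro σ; rw [hu, hΔ]; field_simp; ring
      have hΔsq : ¬ IsSquare Δ := by
        rintro ⟨t, ht⟩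
        refine hsq ⟨2 * r₂ * t, ?_⟩
        have : r₁ ^ 2 - 4 * r₀ * r₂ = Δ * (2 * r₂) ^ 2 := by rw [hΔ]; field_simp
        rw [this, ht]; ring
      -- `‖r₂‖⁻¹‖2‖⁻²(√‖Δ‖)⁻¹ = ‖2‖⁻¹ (√‖D‖)⁻¹`
      have hnr : normAbs F r₂ ≠ 0 := (map_ne_zero (normAbs F)).2 hr₂
      have hΔn : NNReal.sqrt (normAbs F Δ) = NNReal.sqrt (normAbs F (r₁ ^ 2 - 4 * r₀ * r₂)) * (normAbs F 2 * normAbs F r₂)⁻¹ := by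
        rw [hΔ, map_div₀, map_pow, map_mul, NNReal.sqrt_div, NNReal.sqrt_sq, div_eq_mul_inv]
      have hconst : ((normAbs F r₂)⁻¹ * ((normAbs F 2)⁻¹) ^ 2 * (NNReal.sqrt (normAbs F Δ))⁻¹ : ℝ≥0) =
          (normAbs F 2)⁻¹ * (NNReal.sqrt (normAbs F (r₁ ^ 2 - 4 * r₀ * r₂)))⁻¹ := by
        rw [hΔn, mul_inv, inv_inv]
        calc _ = ((normAbs F r₂)⁻¹ * normAbs F r₂) * ((normAbs F 2)⁻¹ * normAbs F 2) *
              ((normAbs F 2)⁻¹ * (NNReal.sqrt (normAbs F (r₁ ^ 2 - 4 * r₀ * r₂)))⁻¹) := by ring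
          _ = _ := by rw [inv_mul_cancel₀ hnr, inv_mul_cancel₀ hn2, one_mul, one_mul]
      simp_rw [hR]
      refine hcase (a := 2 * ((normAbs F 2 : ℝ))⁻¹) (by linarith [inv_pos.2 h20, hqe]) ?_
      have hb := norm_setIntegral_trunc_elliptic_le dx h2 χ hχ2 hr₂ hΔsq u b β
      rw [hconst] at hb
      simp only [NNReal.coe_mul, NNReal.coe_inv] at hb ⊢
      linarith [hb]

/-! ## §4  Uniform domination of the twisted `K`-averages by `|disc|^{-1∕2}` -/

omit [ValuativeRel F] [TopologicalSpace F] [IsNonarchimedeanLocalField F] [MeasurableSpace F] [BorelSpace F] in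
/-- `disc χ_X = (X₁₁ − X₀₀)² − 4·X₁₀·(−X₀₁)` — the discriminant of the cell quadratic `P_X` (Mathlib `Matrix.discr_fin_two`). [folklore] -/
theorem discr_charpoly_eq_cellP (X : Matrix (Fin 2) (Fin 2) F) :
    X.charpoly.discr = (X 1 1 - X 0 0) ^ 2 - 4 * X 1 0 * -X 0 1 := by
  have h : X.charpoly.discr = X.trace ^ 2 - 4 * X.det := Matrix.discr_fin_two X
  rw [h, Matrix.trace_fin_two, Matrix.det_fin_two]; ring

omit [ValuativeRel F] [TopologicalSpace F] [IsNonarchimedeanLocalField F] [MeasurableSpace F] [BorelSpace F] in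
/-- `disc χ_X = (X₀₀ − X₁₁)² − 4·X₀₁·(−X₁₀)` — the discriminant of the cell quadratic `Q_X` (Mathlib `Matrix.discr_fin_two`). [folklore] -/
theorem discr_charpoly_eq_cellQ (X : Matrix (Fin 2) (Fin 2) F) :
    X.charpoly.discr = (X 0 0 - X 1 1) ^ 2 - 4 * X 0 1 * -X 1 0 := by
  have h : X.charpoly.discr = X.trace ^ 2 - 4 * X.det := Matrix.discr_fin_two X
  rw [h, Matrix.trace_fin_two, Matrix.det_fin_two]; ring

variable [MeasurableSpace (GL (Fin 2) F)] [BorelSpace (GL (Fin 2) F)]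

/-- **UNIFORM DOMINATION.**  For a quadratic `χ ≠ 1` (`χ² = 1`, `char F ≠ 2`), `κ` Haar on `K = GL₂(𝒪)`: there is `C` such that for every `n : ℕ` and every
`X ∈ 𝔤𝔩₂(F)` with `disc χ_X ≠ 0`, `|A_n(X)| = |∫_K χ̃(det k)·ω_n((k⁻¹Xk)₁₀) dκ| ≤ C·|disc χ_X|^{-1∕2}` — the bridge (§2) and the 1-D master bound (§3) at
`P_X`, `Q_X` (`disc P_X = disc Q_X = disc χ_X`).  This is the domination used for dominated convergence in (K5) and for the rider `√|disc|·|Fr| ∈ L^∞_loc`.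
[cite: HarishChandra1999AdmissibleDistributions, §7] [cite: LabesseLanglands1979, §2] -/
theorem exists_twistedKAverage_bound (h2 : (2 : F) ≠ 0) (χ : QuasiChar F) (hχ2 : ∀ u, χ u * χ u = 1) (hχ1 : ∃ u, χ u ≠ 1)
    (κ : Measure ↥(glInt 2 F)) [κ.IsHaarMeasure] :
    ∃ C : ℝ, ∀ (n : ℕ) (X : Matrix (Fin 2) (Fin 2) F), IsUnit X.charpoly.discr →
      ‖∫ k : ↥(glInt 2 F), Function.extend ((↑) : Fˣ → F) (fun u => ((χ u : ℂˣ) : ℂ)) 0 (((k : GL (Fin 2) F) : Matrix (Fin 2) (Fin 2) F)).det *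
          (primePowBall F (2 * (n : ℤ)))ᶜ.indicator
            (fun y => Function.extend ((↑) : Fˣ → F) (fun u => ((χ u : ℂˣ) : ℂ)) 0 y * ((((normAbs F y)⁻¹ : ℝ≥0) : ℝ) : ℂ))
            ((((((k : GL (Fin 2) F))⁻¹ : GL (Fin 2) F) : Matrix (Fin 2) (Fin 2) F) * X * ((k : GL (Fin 2) F) : Matrix (Fin 2) (Fin 2) F)) 1 0) ∂κ‖ ≤
        C * (((NNReal.sqrt (normAbs F X.charpoly.discr))⁻¹ : ℝ≥0) : ℝ) := by
  haveI : LocallyCompactSpace F := (isLocalField F).toLocallyCompactSpace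
  haveI : IsTopologicalRing F := inferInstance
  -- any additive Haar measure on `F` will do for the cell side
  obtain ⟨c, hc, hbridge⟩ := exists_twistedKAverage_eq_cells (Measure.addHaar (G := F)) χ hχ2 κ
  obtain ⟨C₀, -, hbound⟩ := exists_forall_norm_setIntegral_trunc_quadratic_le (Measure.addHaar (G := F)) h2 χ hχ2 hχ1
  refine ⟨c * (C₀ + C₀), fun n X hX => ?_⟩
  have hD : X.charpoly.discr ≠ 0 := hX.ne_zero
  have hDP : (X 1 1 - X 0 0) ^ 2 - 4 * X 1 0 * -X 0 1 ≠ 0 := by rwa [← discr_charpoly_eq_cellP X]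
  have hDQ : (X 0 0 - X 1 1) ^ 2 - 4 * X 0 1 * -X 1 0 ≠ 0 := by rwa [← discr_charpoly_eq_cellQ X]
  have hP := hbound (2 * (n : ℤ)) 0 (X 1 0) (X 1 1 - X 0 0) (-X 0 1) hDP
  have hQ := hbound (2 * (n : ℤ)) 1 (X 0 1) (X 0 0 - X 1 1) (-X 1 0) hDQ
  rw [← discr_charpoly_eq_cellP X] at hP
  rw [← discr_charpoly_eq_cellQ X] at hQ
  rw [hbridge n X, norm_mul, Complex.norm_real, Real.norm_eq_abs, abs_of_pos hc]
  calc _ ≤ c * (C₀ * (((NNReal.sqrt (normAbs F X.charpoly.discr))⁻¹ : ℝ≥0) : ℝ) +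
          1 * (C₀ * (((NNReal.sqrt (normAbs F X.charpoly.discr))⁻¹ : ℝ≥0) : ℝ))) := by
        refine mul_le_mul_of_nonneg_left ((norm_add_le _ _).trans (add_le_add hP ((norm_mul_le _ _).trans ?_))) hc.le
        exact mul_le_mul (norm_extend_le_one χ hχ2 _) hQ (norm_nonneg _) zero_le_one
    _ = _ := by ring

end Main

end Summit.HodgeConjecture.HodgeConjecture.Cruxes.H413.K2E3GL2TwistedKAverageCells

end
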